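import Summits.NavierStokesRegularity.NavierStokesRegularity.Theorems.PoloidalWindowDoorPoloidalWindowRigidityZShockPeriodicRecurrence
import HarnessLib

/-!
# Crux K2 `PoloidalWindowRigidity` (stmt-NavierStokesRegularity-19708), line `z_shock` — periodic two-sided Liouville AWAY FROM THE
# INFLECTION SET, no sign hypothesis as input

`--supports stmt-NavierStokesRegularity-19708 --as helper` (leafhand-ns-poloidalwindowdoor-3 g3, cell decomp-ns, 2026-08-31).  Class-free,
Mathlib + tree files only.  **No stub and no summit is closed by this file; Navier–Stokes regularity is NOT proved here (rung 0).**

`pSystem_periodic_const_of_no_inflection` — an `x`-periodic two-sided `C²` solution of the autonomous p-system `p_z = −κ(w)² w_x`,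
`w_z = −p_x` (`0 < κlo ≤ κ(w) ≤ κhi`, `|κ'(w)| ≤ k₁`, `|w_x| ≤ W₁` along the solution, `κ > 0`, `κ ∈ C¹` nowhere linearly degenerate)
whose values AVOID the inflection set — `κ'(w(q)) ≠ 0` at every point `q`, with no a-priori sign — is a constant state.  Proof: by
`…PeriodicRecurrence.periodic_loaded_char_meets_inflection` no forward characteristic is loaded, i.e. `p_x + κ(w) w_x ≡ 0`, and
`…ScalarEternal.pSystem_const_of_forward_flat` (lines cross) finishes.  (The sign of `κ'` on the range follows a posteriori from
connectedness, but is never used; compare `…PSystemNonuniformConst.pSystem_const_nonuniform`, p823120, which needs `κ' ≥ 0` on all of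
`ℝ` and no periodicity.)  So the periodic residual of the census item «R2 with sign-changing `κ'`» consists exactly of solutions that
TOUCH the inflection set — and then, by p824348/p824418, thread it on every loaded characteristic in every height window. [folklore]
-/

noncomputable section

namespace Summit.NavierStokesRegularity.NavierStokesRegularity.Theorems.PoloidalWindowDoorPoloidalWindowRigidityZShockPeriodicLiouville

-- the summit and its single sub-problem share the name (CONVENTIONS §1)
set_option linter.dupNamespace false

open Set Filter Topology Function Metric
open Summit.NavierStokesRegularity.NavierStokesRegularity.Theorems.PoloidalWindowDoorPoloidalWindowRigidityZShockScalarEternal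
open Summit.NavierStokesRegularity.NavierStokesRegularity.Theorems.PoloidalWindowDoorPoloidalWindowRigidityZShockPeriodicRecurrence

variable {w p : ℝ × ℝ → ℝ} {κ κ' K : ℝ → ℝ} {κlo κhi k₁ W₁ P : ℝ}

/-- **Periodic two-sided Liouville away from the inflection set** (hypotheses in the module docstring). [folklore] -/
theorem pSystem_periodic_const_of_no_inflection (hw : ContDiff ℝ 2 w) (hp : ContDiff ℝ 2 p)
    (hK2 : ContDiff ℝ 2 K) (hKd : ∀ v, HasDerivAt K (κ v) v) (hκd : ∀ v, HasDerivAt κ (κ' v) v) (hκ'c : Continuous κ')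
    (hsys1 : ∀ q, fderiv ℝ p q (1, 0) = -(κ (w q) ^ 2 * fderiv ℝ w q (0, 1)))
    (hsys2 : ∀ q, fderiv ℝ w q (1, 0) = -fderiv ℝ p q (0, 1))
    (hκlo0 : 0 < κlo) (hκlo : ∀ q, κlo ≤ κ (w q)) (hκhi : ∀ q, κ (w q) ≤ κhi) (hκpos : ∀ v, 0 < κ v)
    (hgn : ∀ a b : ℝ, a < b → ∃ v ∈ Ioo a b, κ' v ≠ 0)
    (hk₁ : ∀ q, |κ' (w q)| ≤ k₁) (hW₁ : ∀ q, |fderiv ℝ w q (0, 1)| ≤ W₁)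
    (hP : 0 < P) (hPw : ∀ z x, w (z, x + P) = w (z, x)) (hPp : ∀ z x, p (z, x + P) = p (z, x))
    (hnoinfl : ∀ q : ℝ × ℝ, κ' (w q) ≠ 0) :
    ∀ q q' : ℝ × ℝ, w q = w q' ∧ p q = p q' := by
  have hw1 : Differentiable ℝ w := hw.differentiable (by simp)
  have hp1 : Differentiable ℝ p := hp.differentiable (by simp)
  have hκB : ∀ q, |κ (w q)| ≤ κhi := fun q => by rw [abs_of_pos (hκpos _)]; exact hκhi q
  -- no forward characteristic is loaded
  have hflat : ∀ q, fderiv ℝ p q (0, 1) + κ (w q) * fderiv ℝ w q (0, 1) = 0 := by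
    rintro ⟨z₀, x₀⟩
    by_contra h0
    obtain ⟨X, hX0, hX⟩ := exists_global_char hw1 hκd hκB hk₁ hW₁ z₀ x₀
    have h0' : fderiv ℝ p (z₀, X z₀) (0, 1) + κ (w (z₀, X z₀)) * fderiv ℝ w (z₀, X z₀) (0, 1) ≠ 0 := by rwa [hX0]
    obtain ⟨t, ht⟩ := periodic_loaded_char_meets_inflection hw hp hK2 hKd hκd hκ'c hsys1 hsys2 hκlo0 hκlo hκhi hκpos hk₁ hW₁
      hP hPw hPp hX h0'
    exact hnoinfl _ ht
  exact pSystem_const_of_forward_flat hw1 hp1 hκd hsys1 hsys2 hκpos hκhi hk₁ hW₁ hgn hflat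

end Summit.NavierStokesRegularity.NavierStokesRegularity.Theorems.PoloidalWindowDoorPoloidalWindowRigidityZShockPeriodicLiouville

end
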